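import Literature.NumberTheory.Sieve.LinearEquationsInPrimesHostKraNilmanifold
import Literature.NumberTheory.Sieve.LinearEquationsInPrimesRelativeInverse
import Literature.NumberTheory.Sieve.LinearEquationsInPrimesGowersUniformity
import Literature.NumberTheory.Sieve.LinearEquationsInPrimesDualFunctions
import HarnessLib

/-!
# Linear equations in primes: nilsequences obstruct uniformity (Green–Tao 2010, Cor. 11.6) for
# nilmanifolds with rational lower central series

Trunk T-SIEVE (`Literature/NumberTheory/Sieve`), third file of the App. E / §11 programme
(`…HostKraCubes.lean`, `…HostKraNilmanifold.lean`) in the inline decomposition of the named fact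
`Literature.NumberTheory.Sieve.GreenTao2010_gowersUniformity` (B. Green, T. Tao, *Linear
equations in primes*, Ann. of Math. 171 (2010), Thm. 7.2). It PROVES Cor. 11.6 ("Nilsequences
obstruct uniformity, II", the predicate `GreenTao2010_nilObstructionAt s X M` of
`…RelativeInverse.lean`) for every `s`-step nilmanifold `X` whose lower central series is rational
with respect to `Γ` (`X.IsRational`, Lemma E.9 of the paper — see `…HostKraNilmanifold.lean` for
why this theorem of Mal'cev is carried as a hypothesis), hence unconditionally for all
nilmanifolds of step `s ≤ 1`, and records what Thm. 7.2 then rests on: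

* `abs_sum_mul_le_of_cubeApprox` — the averaging / Gowers–Cauchy–Schwarz half of the proof of
  Prop. 11.2, isolated as a statement about real sequences: if `a(m)` is within `ε` of
  `∑_i c_i ∏_{ω ⊆ [k]} b_{i,ω}(m + ω·h)` for all `m ∈ [N]`, `h ∈ ℕ_{≥1}^k`, with `1`-bounded `b`
  and `b_{i,∅} = 1`, then
  `|∑_{n ≤ N} f(n) a(n)| ≤ (∑_i |c_i|) (2(2k+1))^{k+1} N ‖f‖_{U^k[N]} + ε ∑_{n ≤ N} |f(n)|`;
* `Nilmanifold.exists_cubeApprox` — the cube approximation of `…HostKraNilmanifold.lean`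
  (Prop. 11.5 + Stone–Weierstrass) in the indexing `ω ⊆ [s+1]` of the Gowers-norm files;
  `Nilmanifold.exists_finite_net` — a finite `ε`-net of the `1`-bounded `M`-Lipschitz functions
  in the uniform norm (the Arzelà–Ascoli reduction at the start of the proof of Prop. 11.2, here by
  discretisation on a finite net of points);
* `GreenTao2010_nilObstructionAt_of_isRational` — **Cor. 11.6 for rational nilmanifolds**, and
  `GreenTao2010_nilObstructionAt_of_le_one` (all `1`-step nilmanifolds, extending
  `GreenTao2010_nilObstructionAt_one_circle`);
* the assemblies `GreenTao2010_gowersUniformityAt_of_rationalDatum`,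
  `GreenTao2010_gowersUniformity_of_rationalGI_of_orthogonality`,
  `GreenTao2010_gowersUniformity_of_malcev_of_GI_of_orthogonality`,
  `GreenTaoZiegler2012_finiteComplexity_of_malcev_of_GI_of_orthogonality`: Thm. 7.2 (and the
  Green–Tao–Ziegler theorem) now rest on `GI(s)` (with rational data, or as printed plus
  Lemma E.9) and Prop. 10.2 only — Prop. 6.4, Prop. 10.1 ⇐ `GI(s)` + Cor. 11.6, and Cor. 11.6
  being theorems of the tree.

## The proof of Cor. 11.6 (as formalised; §11 of the paper)

Fix `X` rational, `M`, `δ ∈ (0,1)`; `k = s + 1`. (1) Choose a finite `δ/4`-net `(F_i)` of the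
Lipschitz class (`exists_finite_net`); replacing `F` by its net function costs
`≤ (δ/4) 𝔼|f| ≤ δ/4` in the correlation. (2) For each `F_i`, the cube approximation to accuracy
`δ/4` (`exists_cubeApprox`): `F_i(g^m x) = ∑_α c_α ∏_{∅ ≠ ω ⊆ [k]} B_{α,ω}(g^{m+ω·h} x) + O(δ/4)`
for ALL `g, x, m, h`, with `L_i = ∑_α |c_α|` depending on `F_i, δ` only — this is Prop. 11.5
(the corner of a Host–Kra cube is a continuous function of the other vertices, on the compact
cube space) and Stone–Weierstrass. (3) For `n ∈ [N]` average over the `N^k` shifts `h` with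
`n + h_j ∈ [N+1, 2N]` — a constraint expressible by vertex functions at the vertices `{j}` — so
that `N^k ∑_n f(n) F_i(gⁿx)` is, up to `(δ/4) N^k ∑|f|`, a combination of sums over all cubes of
`[V]`, `V = (2k+1)N`, of vertex-family products with `f 1_{[N]}` at `ω = ∅` and `1`-bounded
functions elsewhere; transferred to `ℤ_{N''}`, `N'' = 2V` (no wrap-around, the Lemma B.5
machinery of `…RelativeInverse.lean`), each is `N''^{k+1}` times a Gowers inner product, bounded by
`‖f 1_{[N]}‖_{U^k(ℤ_{N''})} ≤ ‖f‖_{U^k[N]}` (Gowers–Cauchy–Schwarz, `…DualFunctions.lean`, and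
the cube count). Hence `|𝔼_n f(n) F_i(gⁿx)| ≤ L_i (2(2k+1))^{k+1} ‖f‖_{U^k[N]} + δ/4`, and with
(1), `δ ≤ |𝔼 f F|` forces `‖f‖_{U^{s+1}[N]} ≥ (δ/2) / ((2(2k+1))^{k+1} (1 + ∑_i L_i))`.
The paper averages `h` over `[N]^{s+1}` with a smooth cutoff and removes it by Fourier expansion;
the shifted window `[N+1, 2N]` makes the cutoff a vertex function and the count exactly `N^k`,
which avoids Fourier analysis (and complex-valued Gowers norms) altogether.

## References

* B. Green, T. Tao, *Linear equations in primes*, Ann. of Math. (2) 171 (2010), 1753–1850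
  (arXiv:math/0606088): §11 (Def. 11.1, Prop. 11.2 and its proof, Def. 11.4, Prop. 11.5,
  Cor. 11.6), App. B (Lemma B.5), App. E (Lemma E.9), §10 (Prop. 10.1, proof of Thm. 7.2).
* B. Green, T. Tao, T. Ziegler, *An inverse theorem for the Gowers `U^{s+1}[N]`-norm*, Ann. of
  Math. (2) 176 (2012), 1231–1372, Thm. 1.3.
-/

noncomputable section

open Finset
open scoped BigOperators

namespace Literature.NumberTheory.Sieve

section core

variable {N'' : ℕ} [NeZero N'']

/-- For a vertex family of functions on `ℤ` supported in `[1, V]`, `2V ≤ N''`, the sum over the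
cubes of `[V]` of `∏_ω F_ω(x + ω·h)` is `N''^{k+1}` times the Gowers inner product on `ℤ_{N''}`
of the transported family (no wrap-around). [cite: GreenTao2010, App. B, proof of Lemma B.5] -/
theorem sum_cubeParams_eq_card_mul_gowersInner {k V : ℕ} (hV : 2 * V ≤ N'')
    (Fam : Finset (Fin k) → ℤ → ℝ) :
    ∑ p ∈ gowersCubeParams k V, ∏ ω : Finset (Fin k), Fam ω (cubeVertex p.1 p.2 ω) =
      (N'' : ℝ) ^ (k + 1) * gowersInner k (fun ω => extendByZero N'' V (Fam ω)) := by
  classical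
  have hN''pos : 0 < N'' := Nat.pos_of_ne_zero (NeZero.ne N'')
  have hVN : V < N'' := by omega
  set P := gowersCubeParams k V with hP
  set G : ZMod N'' × (Fin k → ZMod N'') → ℝ :=
    fun q => cubeProd k (fun ω => extendByZero N'' V (Fam ω)) q.1 q.2 with hG
  have hinj := reduceParams_injOn (k := k) (N' := N'') hVN
  have hsum : ∑ q, G q = ∑ p ∈ P, ∏ ω : Finset (Fin k), Fam ω (cubeVertex p.1 p.2 ω) := by
    rw [← Finset.sum_subset (Finset.subset_univ (P.image (reduceParams N'')))]
    · rw [Finset.sum_image hinj]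
      refine Finset.sum_congr rfl fun p hp => ?_
      simp only [hG, cubeProd]
      refine Fintype.prod_congr _ _ fun ω => ?_
      rw [reduceParams_vertex]
      have hv := Finset.mem_Icc.mp (mem_gowersCubeParams.mp hp ω)
      exact extendByZero_intCast hVN (Fam ω) hv.1 hv.2
    · intro q _ hq
      by_contra hne
      apply hq
      have hall : ∀ ω : Finset (Fin k),
          extendByZero N'' V (Fam ω) (q.1 + ∑ j ∈ ω, q.2 j) ≠ 0 := by
        intro ω h0
        exact hne (Finset.prod_eq_zero (Finset.mem_univ ω) h0)
      obtain ⟨p, hp, hpq⟩ := exists_lift_of_vertices hV q fun ω => extendByZero_ne_zero (hall ω)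
      exact Finset.mem_image.mpr ⟨p, hp, hpq⟩
  have hcard : (Fintype.card (ZMod N'' × (Fin k → ZMod N'')) : ℝ) = (N'' : ℝ) ^ (k + 1) := by
    rw [Fintype.card_prod, Fintype.card_pi, Finset.prod_const, Finset.card_univ, Fintype.card_fin,
      ZMod.card]
    push_cast
    ring
  unfold gowersInner
  rw [Fintype.expect_eq_sum_div_card, hsum, hcard, mul_div_cancel₀]
  positivity

/-- `‖g‖_{U^k}^{2^k} ≤ 1` for `1`-bounded `g`. [folklore] -/
theorem gowersPower_le_one_of_abs_le {k : ℕ} {g : ZMod N'' → ℝ} (hg : ∀ x, |g x| ≤ 1) :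
    gowersPower k g ≤ 1 := by
  unfold gowersPower
  refine (le_abs_self _).trans ((Finset.abs_expect_le _ _).trans ?_)
  refine (Finset.expect_le_expect fun p _ => ?_).trans (by rw [Finset.expect_const Finset.univ_nonempty])
  unfold gowersProd
  rw [Finset.abs_prod]
  exact Finset.prod_le_one (fun _ _ => abs_nonneg _) fun ω _ => hg _

omit [NeZero N''] in
/-- `#{cubes ⊆ [N]} ≤ N (2N+1)^k` (the parameter box). [folklore] -/
theorem card_gowersCubeParams_le (k N : ℕ) : (gowersCubeParams k N).card ≤ N * (2 * N + 1) ^ k := by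
  unfold gowersCubeParams
  refine (Finset.card_filter_le _ _).trans ?_
  rw [Finset.card_product, Fintype.card_piFinset, Finset.prod_const, Finset.card_univ,
    Fintype.card_fin, Int.card_Icc, Int.card_Icc]
  have h1 : ((N : ℤ) + 1 - 1).toNat = N := by simp
  have h2 : ((N : ℤ) + 1 - -(N : ℤ)).toNat = 2 * N + 1 := by omega
  rw [h1, h2]

/-- `‖f 1_{[N]}‖_{U^k(ℤ_{N''})}^{2^k} ≤ ‖f‖_{U^k[N]}^{2^k}` once `N'' ≥ 2N + 1` (the cube count is at
most `N''^{k+1}`). [cite: GreenTao2010, App. B, Lemma B.5] -/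
theorem gowersPower_extendByZero_le_uniformityNorm_pow {k N : ℕ} (hk : 1 ≤ k) (hN1 : 1 ≤ N)
    (hN : 2 * N + 1 ≤ N'') (f : ℤ → ℝ) :
    gowersPower k (extendByZero N'' N f) ≤ uniformityNorm k N (fun n => ((f n : ℝ) : ℂ)) ^ (2 ^ k) := by
  rw [gowersPower_extendByZero_eq hk hN1 (by omega) f]
  refine mul_le_of_le_one_left (pow_nonneg (uniformityNorm_nonneg _ _ _) _) ?_
  have hN''pos : (0 : ℝ) < N'' := by exact_mod_cast (show 0 < N'' by omega)
  rw [div_le_one (by positivity)]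
  calc ((gowersCubeParams k N).card : ℝ) ≤ N * (2 * N + 1) ^ k := by
        exact_mod_cast card_gowersCubeParams_le k N
    _ ≤ N'' * (N'' : ℝ) ^ k := by
        have h1 : (N : ℝ) ≤ N'' := by exact_mod_cast (show N ≤ N'' by omega)
        have h2 : (2 * N + 1 : ℝ) ≤ N'' := by exact_mod_cast hN
        gcongr
    _ = (N'' : ℝ) ^ (k + 1) := by ring

end core

/-- **The averaging and Gowers–Cauchy–Schwarz half of the proof of Prop. 11.2 / Cor. 11.6**, as a
statement about sequences: if a sequence `a(m)` is, for every `m ∈ [N]` and every `h ∈ ℕ_{≥1}^k`,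
within `ε` of `∑_i c_i ∏_{ω} b_{i,ω}(m + ω·h)` with `1`-bounded `b_{i,ω}` and `b_{i,∅} = 1`, then
for every `f : [N] → ℝ`,
`|∑_{n ∈ [N]} f(n) a(n)| ≤ (∑_i |c_i|) (2(2k+1))^{k+1} N ‖f‖_{U^k[N]} + ε ∑_{n ∈ [N]} |f(n)|`
(average over the `N^k` shifts `h` with `n + h_j ∈ [N+1, 2N]`, which are counted by vertex
functions, transfer to `ℤ_{N''}`, `N'' = 2(2k+1)N`, and Gowers–Cauchy–Schwarz).
[cite: GreenTao2010, §11, proof of Prop. 11.2 ((11.4)–(11.8))] -/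
theorem abs_sum_mul_le_of_cubeApprox {k N : ℕ} (hk : 1 ≤ k) (hN : 1 ≤ N) {ε : ℝ}
    (a : ℤ → ℝ) {ι : Type*} [Fintype ι] (c : ι → ℝ) (b : ι → Finset (Fin k) → ℤ → ℝ)
    (hb1 : ∀ i ω m, |b i ω m| ≤ 1) (hb0 : ∀ i m, b i ∅ m = 1)
    (happrox : ∀ (m : ℤ) (h : Fin k → ℤ), 1 ≤ m → m ≤ N → (∀ j, 1 ≤ h j) →
      |a m - ∑ i, c i * ∏ ω : Finset (Fin k), b i ω (m + ∑ j ∈ ω, h j)| ≤ ε)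
    (f : ℤ → ℝ) :
    |∑ n ∈ Icc (1 : ℤ) N, f n * a n| ≤
      (∑ i, |c i|) * (2 * (2 * k + 1)) ^ (k + 1) * N * uniformityNorm k N (fun n => ((f n : ℝ) : ℂ)) +
        ε * ∑ n ∈ Icc (1 : ℤ) N, |f n| := by
  classical
  -- parameters
  set V : ℕ := (2 * k + 1) * N with hV
  set N'' : ℕ := 2 * V with hN''
  have hV1 : 1 ≤ V := by rw [hV]; nlinarith
  haveI : NeZero N'' := ⟨by omega⟩
  set U := uniformityNorm k N (fun n => ((f n : ℝ) : ℂ)) with hU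
  have hU0 : 0 ≤ U := uniformityNorm_nonneg _ _ _
  set Hbox : Finset (Fin k → ℤ) := Fintype.piFinset fun _ => Icc (1 : ℤ) (2 * N) with hHbox
  set A : Finset (ℤ × (Fin k → ℤ)) := Icc (1 : ℤ) N ×ˢ Hbox with hA
  -- the weight counting the admissible shifts
  set w : ℤ × (Fin k → ℤ) → ℝ := fun p =>
    ∏ j, if (N : ℤ) + 1 ≤ p.1 + p.2 j ∧ p.1 + p.2 j ≤ 2 * N then (1 : ℝ) else 0 with hw
  have hw_nonneg : ∀ p, 0 ≤ w p := fun p =>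
    Finset.prod_nonneg fun j _ => by split_ifs <;> norm_num
  -- Step 1: exactly `N^k` admissible shifts for each `n ∈ [N]`
  have hcount : ∀ n ∈ Icc (1 : ℤ) N, ∑ h ∈ Hbox, w (n, h) = (N : ℝ) ^ k := by
    intro n hn
    rw [Finset.mem_Icc] at hn
    have h1 : ∑ t ∈ Icc (1 : ℤ) (2 * N),
        (if (N : ℤ) + 1 ≤ n + t ∧ n + t ≤ 2 * N then (1 : ℝ) else 0) = N := by
      rw [Finset.sum_ite, Finset.sum_const_zero, add_zero, Finset.sum_const, nsmul_eq_mul, mul_one]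
      have e : (Icc (1 : ℤ) (2 * N)).filter (fun t => (N : ℤ) + 1 ≤ n + t ∧ n + t ≤ 2 * N) =
          Icc ((N : ℤ) + 1 - n) (2 * N - n) := by
        ext t
        simp only [Finset.mem_filter, Finset.mem_Icc]
        omega
      rw [e, Int.card_Icc]
      have e2 : (2 * (N : ℤ) - n + 1 - ((N : ℤ) + 1 - n)).toNat = N := by omega
      rw [e2]
    rw [hHbox, Finset.sum_prod_piFinset (Icc (1 : ℤ) (2 * N))
      (fun (_ : Fin k) (t : ℤ) => if (N : ℤ) + 1 ≤ n + t ∧ n + t ≤ 2 * N then (1 : ℝ) else 0)]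
    rw [Finset.prod_congr rfl fun j _ => h1, Finset.prod_const, Finset.card_univ, Fintype.card_fin]
  -- Step 2: multiply by `N^k`
  have hstep2 : ∀ G : ℤ → ℝ, (N : ℝ) ^ k * ∑ n ∈ Icc (1 : ℤ) N, G n =
      ∑ p ∈ A, w p * G p.1 := by
    intro G
    rw [hA, Finset.sum_product, Finset.mul_sum]
    refine Finset.sum_congr rfl fun n hn => ?_
    change _ = ∑ y ∈ Hbox, w (n, y) * G n
    rw [← Finset.sum_mul, hcount n hn]
  -- the cube products of the `b`'s
  set Q : ι → ℤ × (Fin k → ℤ) → ℝ := fun i p =>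
    ∏ ω : Finset (Fin k), b i ω (p.1 + ∑ j ∈ ω, p.2 j) with hQ
  set T : ι → ℝ := fun i => ∑ p ∈ A, w p * (f p.1 * Q i p) with hT
  -- Step 3/4: the approximation, averaged
  have hstep4 : |(N : ℝ) ^ k * ∑ n ∈ Icc (1 : ℤ) N, f n * a n - ∑ i, c i * T i| ≤
      ε * ((N : ℝ) ^ k * ∑ n ∈ Icc (1 : ℤ) N, |f n|) := by
    have e1 : ∑ i, c i * T i = ∑ p ∈ A, w p * (f p.1 * ∑ i, c i * Q i p) := by
      calc ∑ i, c i * T i = ∑ i, ∑ p ∈ A, c i * (w p * (f p.1 * Q i p)) := by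
            refine Finset.sum_congr rfl fun i _ => ?_
            simp only [hT]
            rw [Finset.mul_sum]
        _ = ∑ p ∈ A, ∑ i, c i * (w p * (f p.1 * Q i p)) := Finset.sum_comm
        _ = ∑ p ∈ A, w p * (f p.1 * ∑ i, c i * Q i p) := by
            refine Finset.sum_congr rfl fun p _ => ?_
            rw [Finset.mul_sum, Finset.mul_sum]
            exact Finset.sum_congr rfl fun i _ => by ring
    rw [hstep2 (fun n => f n * a n), hstep2 (fun n => |f n|), e1, ← Finset.sum_sub_distrib,
      Finset.mul_sum]
    refine (Finset.abs_sum_le_sum_abs _ _).trans (Finset.sum_le_sum fun p hp => ?_)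
    rw [hA, Finset.mem_product, Finset.mem_Icc, hHbox, Fintype.mem_piFinset] at hp
    have hh : ∀ j, 1 ≤ p.2 j := fun j => (Finset.mem_Icc.mp (hp.2 j)).1
    have hap := happrox p.1 p.2 hp.1.1 hp.1.2 hh
    rw [← mul_sub, ← mul_sub, abs_mul, abs_mul, abs_of_nonneg (hw_nonneg p)]
    calc w p * (|f p.1| * |a p.1 - ∑ i, c i * Q i p|) ≤ w p * (|f p.1| * ε) :=
          mul_le_mul_of_nonneg_left (mul_le_mul_of_nonneg_left hap (abs_nonneg _)) (hw_nonneg p)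
      _ = ε * (w p * |f p.1|) := by ring
  -- Step 5: `T i` is a sum over the cubes of `[V]` of a vertex-family product
  set Fam : ι → Finset (Fin k) → ℤ → ℝ := fun i ω m =>
    if ω = ∅ then (if 1 ≤ m ∧ m ≤ N then f m else 0)
    else if ω.card = 1 then (if (N : ℤ) + 1 ≤ m ∧ m ≤ 2 * N then b i ω m else 0)
    else (if 1 ≤ m ∧ m ≤ V then b i ω m else 0) with hFam
  set φ : ι → ℤ × (Fin k → ℤ) → ℝ := fun i p =>
    ∏ ω : Finset (Fin k), Fam i ω (cubeVertex p.1 p.2 ω) with hφ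
  have hFam1 : ∀ i ω m, ω ≠ ∅ → |Fam i ω m| ≤ 1 := by
    intro i ω m hω
    simp only [hFam, hω, if_false]
    split_ifs <;> simp [hb1]
  -- membership facts
  have hmemA : ∀ p ∈ A, (1 ≤ p.1 ∧ p.1 ≤ N) ∧ ∀ j, 1 ≤ p.2 j ∧ p.2 j ≤ 2 * N := by
    intro p hp
    rw [hA, Finset.mem_product, Finset.mem_Icc, hHbox, Fintype.mem_piFinset] at hp
    exact ⟨hp.1, fun j => Finset.mem_Icc.mp (hp.2 j)⟩
  -- the vertex bound `1 ≤ x + ω·h ≤ V` on `A`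
  have hvertex : ∀ p ∈ A, ∀ ω : Finset (Fin k),
      1 ≤ cubeVertex p.1 p.2 ω ∧ cubeVertex p.1 p.2 ω ≤ V := by
    intro p hp ω
    obtain ⟨hp1, hph⟩ := hmemA p hp
    unfold cubeVertex
    have hs0 : 0 ≤ ∑ j ∈ ω, p.2 j := Finset.sum_nonneg fun j _ => by linarith [(hph j).1]
    have hs1 : ∑ j ∈ ω, p.2 j ≤ ∑ _j ∈ ω, (2 * N : ℤ) := Finset.sum_le_sum fun j _ => (hph j).2
    rw [Finset.sum_const, nsmul_eq_mul] at hs1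
    have hcardω : (ω.card : ℤ) ≤ k := by
      exact_mod_cast (Finset.card_le_univ ω).trans (by rw [Fintype.card_fin])
    have hVZ : (V : ℤ) = (2 * k + 1) * N := by rw [hV]; push_cast; ring
    constructor
    · linarith
    · have : (ω.card : ℤ) * (2 * N) ≤ k * (2 * N) := by
        have hN0 : (0 : ℤ) ≤ 2 * N := by positivity
        nlinarith
      linarith
  -- on `A`, the weighted cube product is the family product
  have hφA : ∀ i, ∀ p ∈ A, w p * (f p.1 * Q i p) = φ i p := by
    intro i p hp
    obtain ⟨hp1, hph⟩ := hmemA p hp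
    by_cases hall : ∀ j, (N : ℤ) + 1 ≤ p.1 + p.2 j ∧ p.1 + p.2 j ≤ 2 * N
    · have hw1 : w p = 1 := Finset.prod_eq_one fun j _ => if_pos (hall j)
      rw [hw1, one_mul]
      have key : ∀ ω : Finset (Fin k), Fam i ω (cubeVertex p.1 p.2 ω) =
          (if ω = ∅ then f p.1 else 1) * b i ω (cubeVertex p.1 p.2 ω) := by
        intro ω
        by_cases hω : ω = ∅
        · subst hω
          simp only [hFam, if_true, cubeVertex_empty, hb0, mul_one]
          rw [if_pos hp1]
        · by_cases hc : ω.card = 1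
          · obtain ⟨j, rfl⟩ := Finset.card_eq_one.mp hc
            simp only [hFam, hω, if_false, hc, if_true, cubeVertex_singleton, one_mul]
            rw [if_pos (hall j)]
          · simp only [hFam, hω, if_false, hc, one_mul]
            rw [if_pos (hvertex p hp ω)]
      simp only [hφ, hQ]
      rw [Finset.prod_congr rfl fun ω _ => key ω, Finset.prod_mul_distrib]
      congr 1
      · rw [Finset.prod_ite_eq']
        simp
    · push Not at hall
      obtain ⟨j, hj⟩ := hall
      have hw0 : w p = 0 := by
        refine Finset.prod_eq_zero (Finset.mem_univ j) ?_
        rw [if_neg]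
        intro h
        have := hj h.1
        omega
      rw [hw0, zero_mul]
      symm
      refine Finset.prod_eq_zero (Finset.mem_univ ({j} : Finset (Fin k))) ?_
      have hne : ({j} : Finset (Fin k)) ≠ ∅ := Finset.singleton_ne_empty j
      simp only [hFam, hne, if_false, Finset.card_singleton, if_true, cubeVertex_singleton]
      rw [if_neg]
      intro h
      have := hj h.1
      omega
  -- off `A`, the family product vanishes on the cubes of `[V]`
  have hφ_off_A : ∀ i, ∀ p ∈ gowersCubeParams k V, p ∉ A → φ i p = 0 := by
    intro i p hp hpA
    by_cases h1 : 1 ≤ p.1 ∧ p.1 ≤ N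
    · -- then some `h_j ∉ [1, 2N]`, and the `{j}`-factor vanishes
      have h2 : ¬ ∀ j, 1 ≤ p.2 j ∧ p.2 j ≤ 2 * N := by
        intro hall
        apply hpA
        rw [hA, Finset.mem_product, Finset.mem_Icc, hHbox, Fintype.mem_piFinset]
        exact ⟨h1, fun j => Finset.mem_Icc.mpr (hall j)⟩
      push Not at h2
      obtain ⟨j, hj⟩ := h2
      refine Finset.prod_eq_zero (Finset.mem_univ ({j} : Finset (Fin k))) ?_
      have hne : ({j} : Finset (Fin k)) ≠ ∅ := Finset.singleton_ne_empty j
      simp only [hFam, hne, if_false, Finset.card_singleton, if_true, cubeVertex_singleton]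
      rw [if_neg]
      intro h
      have h3 : 1 ≤ p.2 j := by omega
      have h4 := hj h3
      omega
    · refine Finset.prod_eq_zero (Finset.mem_univ (∅ : Finset (Fin k))) ?_
      simp only [hFam, if_true, cubeVertex_empty]
      rw [if_neg h1]
  -- off the cubes of `[V]`, the family product vanishes on `A`
  have hφ_off_P : ∀ i, ∀ p ∈ A, p ∉ gowersCubeParams k V → φ i p = 0 := by
    intro i p hp hpP
    exfalso
    exact hpP (mem_gowersCubeParams.mpr fun ω => Finset.mem_Icc.mpr (hvertex p hp ω))
  have hT_eq : ∀ i, T i = ∑ p ∈ gowersCubeParams k V, φ i p := by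
    intro i
    simp only [hT]
    rw [Finset.sum_congr rfl (hφA i)]
    have h1 : ∑ p ∈ A ∩ gowersCubeParams k V, φ i p = ∑ p ∈ A, φ i p :=
      Finset.sum_subset Finset.inter_subset_left fun p hpA hpn =>
        hφ_off_P i p hpA fun hpP => hpn (Finset.mem_inter.mpr ⟨hpA, hpP⟩)
    have h2 : ∑ p ∈ A ∩ gowersCubeParams k V, φ i p = ∑ p ∈ gowersCubeParams k V, φ i p :=
      Finset.sum_subset Finset.inter_subset_right fun p hpP hpn =>
        hφ_off_A i p hpP fun hpA => hpn (Finset.mem_inter.mpr ⟨hpA, hpP⟩)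
    rw [← h1, h2]
  -- Step 6: the Gowers–Cauchy–Schwarz bound for each `T i`
  have h2V : 2 * V ≤ N'' := le_rfl
  have hTi : ∀ i, |T i| ≤ (N'' : ℝ) ^ (k + 1) * U := by
    intro i
    rw [hT_eq i, sum_cubeParams_eq_card_mul_gowersInner h2V (Fam i), abs_mul,
      abs_of_nonneg (by positivity)]
    refine mul_le_mul_of_nonneg_left ?_ (by positivity)
    refine (abs_gowersInner_le hk _).trans ?_
    rw [Fintype.prod_eq_mul_prod_compl (∅ : Finset (Fin k))]
    have hmain : gowersPower k (extendByZero N'' V (Fam i ∅)) ^ ((2 ^ k : ℕ) : ℝ)⁻¹ ≤ U := by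
      have hext : extendByZero N'' V (Fam i ∅) = extendByZero N'' N f := by
        funext y
        unfold extendByZero
        simp only [hFam, if_true]
        by_cases hy : 1 ≤ y.val ∧ y.val ≤ N
        · have hy' : 1 ≤ y.val ∧ y.val ≤ V := ⟨hy.1, hy.2.trans (by rw [hV]; nlinarith)⟩
          rw [if_pos hy', if_pos hy, if_pos]
          exact ⟨by exact_mod_cast hy.1, by exact_mod_cast hy.2⟩
        · rw [if_neg hy]
          split_ifs with h1 h2
          · exfalso; exact hy ⟨by exact_mod_cast h2.1, by exact_mod_cast h2.2⟩
          · rfl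
          · rfl
      rw [hext]
      have hpow := gowersPower_extendByZero_le_uniformityNorm_pow hk hN
        (show 2 * N + 1 ≤ N'' by rw [hN'', hV]; nlinarith) f
      have hm0 : (2 ^ k : ℕ) ≠ 0 := by positivity
      calc gowersPower k (extendByZero N'' N f) ^ ((2 ^ k : ℕ) : ℝ)⁻¹
          ≤ (U ^ (2 ^ k)) ^ ((2 ^ k : ℕ) : ℝ)⁻¹ :=
            Real.rpow_le_rpow (gowersPower_nonneg hk _) hpow (by positivity)
        _ = U := Real.pow_rpow_inv_natCast hU0 hm0
    have hrest : ∏ ω ∈ ({∅} : Finset (Finset (Fin k)))ᶜ,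
        gowersPower k (extendByZero N'' V (Fam i ω)) ^ ((2 ^ k : ℕ) : ℝ)⁻¹ ≤ 1 := by
      refine Finset.prod_le_one (fun ω _ => Real.rpow_nonneg (gowersPower_nonneg hk _) _)
        fun ω hω => ?_
      have hω : ω ≠ ∅ := by simpa using hω
      refine Real.rpow_le_one (gowersPower_nonneg hk _) (gowersPower_le_one_of_abs_le fun y => ?_)
        (by positivity)
      unfold extendByZero
      split_ifs
      · exact hFam1 i ω _ hω
      · simp
    calc _ ≤ U * 1 := mul_le_mul hmain hrest (Finset.prod_nonneg fun ω _ =>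
          Real.rpow_nonneg (gowersPower_nonneg hk _) _) hU0
      _ = U := mul_one U
  -- Step 7: conclusion
  have hNk : (0 : ℝ) < (N : ℝ) ^ k := by positivity
  have hsumT : |∑ i, c i * T i| ≤ (∑ i, |c i|) * ((N'' : ℝ) ^ (k + 1) * U) := by
    rw [Finset.sum_mul]
    refine (Finset.abs_sum_le_sum_abs _ _).trans (Finset.sum_le_sum fun i _ => ?_)
    rw [abs_mul]
    exact mul_le_mul_of_nonneg_left (hTi i) (abs_nonneg _)
  have htri : (N : ℝ) ^ k * |∑ n ∈ Icc (1 : ℤ) N, f n * a n| ≤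
      |∑ i, c i * T i| + ε * ((N : ℝ) ^ k * ∑ n ∈ Icc (1 : ℤ) N, |f n|) := by
    have h := abs_sub_abs_le_abs_sub ((N : ℝ) ^ k * ∑ n ∈ Icc (1 : ℤ) N, f n * a n)
      (∑ i, c i * T i)
    rw [abs_mul, abs_of_pos hNk] at h
    linarith [hstep4]
  have hN''eq : (N'' : ℝ) ^ (k + 1) = (2 * (2 * k + 1)) ^ (k + 1) * N * (N : ℝ) ^ k := by
    rw [hN'', hV]
    push_cast
    rw [show (2 * ((2 * (k : ℝ) + 1) * N)) = (2 * (2 * k + 1)) * N by ring, mul_pow, pow_succ,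
      pow_succ]
    ring
  have key : (N : ℝ) ^ k * |∑ n ∈ Icc (1 : ℤ) N, f n * a n| ≤
      (N : ℝ) ^ k * ((∑ i, |c i|) * (2 * (2 * k + 1)) ^ (k + 1) * N * U +
        ε * ∑ n ∈ Icc (1 : ℤ) N, |f n|) := by
    have := htri.trans (add_le_add hsumT le_rfl)
    rw [hN''eq] at this
    nlinarith [this]
  exact le_of_mul_le_mul_left key hNk

/-! ### From the cube space to cube approximations along orbits, indexed by `ω ⊆ [s+1]` -/

namespace Nilmanifold

open HostKra

variable {s : ℕ} (X : Nilmanifold s)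

/-- The Boolean vertex `(1_{i ∈ ω})_i ∈ {0,1}^{s+1}` of a subset `ω ⊆ [s+1]` (the dictionary
between the two indexings of the cube used in this series). [folklore] -/
def toVertex (ω : Finset (Fin (s + 1))) : Vertex (s + 1) := fun i => decide (i ∈ ω)

omit X in
/-- `ω ↦ (1_{i ∈ ω})_i` is a bijection `𝒫([s+1]) ≃ {0,1}^{s+1}`. [folklore] -/
def vertexEquiv : Finset (Fin (s + 1)) ≃ Vertex (s + 1) where
  toFun := toVertex
  invFun v := Finset.univ.filter fun i => v i = true
  left_inv ω := by ext i; simp [toVertex]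
  right_inv v := by funext i; simp [toVertex]

omit X in
/-- `∅ ↦ 0^{s+1}`, and only `∅`. [folklore] -/
theorem toVertex_eq_bot_iff (ω : Finset (Fin (s + 1))) :
    toVertex ω = (fun _ => false) ↔ ω = ∅ := by
  constructor
  · intro h
    ext i
    have hi := congr_fun h i
    simp only [toVertex, decide_eq_false_iff_not] at hi
    simp [hi]
  · rintro rfl
    funext i
    simp [toVertex]

omit X in
/-- `(1_{i∈ω})_i · h = ∑_{j ∈ ω} h_j`. [folklore] -/
theorem dot_toVertex (ω : Finset (Fin (s + 1))) (h : Fin (s + 1) → ℤ) :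
    dot (toVertex ω) h = ∑ j ∈ ω, h j := by
  unfold dot toVertex
  simp only [Bool.cond_decide]
  rw [Finset.sum_ite_mem, Finset.univ_inter]

/-- **Cube approximation of a continuous function along orbits** (the Stone–Weierstrass step of
Prop. 11.2 in the indexing `ω ⊆ [s+1]` of the Gowers-norm files, with a trivial factor at
`ω = ∅`): for a rational nilmanifold, continuous `F` and `ε > 0` there are coefficients `c_i` and
`1`-bounded `B_{i,ω} : G/Γ → ℝ`, `B_{i,∅} = 1`, with
`|F(g^m x) - ∑_i c_i ∏_{ω ⊆ [s+1]} B_{i,ω}(g^{m + ∑_{j∈ω} h_j} x)| ≤ ε` for all `g, x` and all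
`m ∈ ℤ`, `h ∈ ℤ^{s+1}`. [cite: GreenTao2010, §11, proof of Prop. 11.2] -/
theorem exists_cubeApprox (hX : X.IsRational) {F : X.G ⧸ X.Γ → ℝ} (hF : Continuous F)
    {ε : ℝ} (hε : 0 < ε) :
    ∃ (n : ℕ) (c : Fin n → ℝ) (B : Fin n → Finset (Fin (s + 1)) → X.G ⧸ X.Γ → ℝ),
      (∀ i ω z, |B i ω z| ≤ 1) ∧ (∀ i z, B i ∅ z = 1) ∧
        ∀ (g : X.G) (x : X.G ⧸ X.Γ) (m : ℤ) (h : Fin (s + 1) → ℤ),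
          |F (g ^ m • x) -
              ∑ i, c i * ∏ ω : Finset (Fin (s + 1)), B i ω (g ^ (m + ∑ j ∈ ω, h j) • x)| ≤ ε := by
  classical
  obtain ⟨n, c, H, -, hH1, happrox⟩ := X.exists_vertexProd_near hX hF hε
  refine ⟨n, c, fun i ω z =>
    if hω : toVertex ω = (fun _ => false) then 1 else H i ⟨toVertex ω, hω⟩ z, ?_, ?_, ?_⟩
  · intro i ω z
    dsimp only
    split_ifs
    · simp
    · exact hH1 _ _ _
  · intro i z
    dsimp only
    rw [dif_pos ((toVertex_eq_bot_iff ∅).mpr rfl)]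
  · intro g x m h
    dsimp only
    have hy := X.parallelepiped_mem_cubeSpace g x m h
    have key := happrox _ hy
    have e0 : g ^ (m + dot (fun _ : Fin (s + 1) => false) h) • x = g ^ m • x := by
      simp [dot]
    simp only [e0] at key
    -- the vertex products agree
    set Bv : Fin n → Vertex (s + 1) → ℝ := fun i v =>
      if hv : v = (fun _ => false) then 1 else H i ⟨v, hv⟩ (g ^ (m + dot v h) • x) with hBv
    have hprod : ∀ i, ∏ ω : Finset (Fin (s + 1)),
        (if hω : toVertex ω = (fun _ => false) then (1 : ℝ)
          else H i ⟨toVertex ω, hω⟩ (g ^ (m + ∑ j ∈ ω, h j) • x)) =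
        ∏ ω : PuncturedVertex (s + 1), H i ω (g ^ (m + dot ω.1 h) • x) := by
      intro i
      have h1 : ∏ ω : Finset (Fin (s + 1)),
          (if hω : toVertex ω = (fun _ => false) then (1 : ℝ)
            else H i ⟨toVertex ω, hω⟩ (g ^ (m + ∑ j ∈ ω, h j) • x)) =
          ∏ ω : Finset (Fin (s + 1)), Bv i (vertexEquiv ω) := by
        refine Fintype.prod_congr _ _ fun ω => ?_
        change _ = Bv i (toVertex ω)
        simp only [hBv, dot_toVertex]
      have h2 : ∏ ω : Finset (Fin (s + 1)), Bv i (vertexEquiv ω) = ∏ v : Vertex (s + 1), Bv i v :=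
        Fintype.prod_equiv vertexEquiv _ _ fun ω => rfl
      have h3 : ∏ v : Vertex (s + 1), Bv i v =
          ∏ v ∈ ({(fun _ => false : Vertex (s + 1))} : Finset (Vertex (s + 1)))ᶜ, Bv i v := by
        rw [Fintype.prod_eq_mul_prod_compl (fun _ => false : Vertex (s + 1))]
        simp only [hBv, dif_pos rfl, one_mul]
      have h4 : ∏ v ∈ ({(fun _ => false : Vertex (s + 1))} : Finset (Vertex (s + 1)))ᶜ, Bv i v =
          ∏ ω : PuncturedVertex (s + 1), Bv i ω.1 :=
        Finset.prod_subtype _ (fun v => by simp) _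
      rw [h1, h2, h3, h4]
      refine Fintype.prod_congr _ _ fun ω => ?_
      simp only [hBv, dif_neg ω.2]
    simp_rw [hprod]
    exact key

/-! ### A finite sup-norm net for the bounded Lipschitz class (Arzelà–Ascoli, discretised) -/

/-- **Finite `ε`-net of the `1`-bounded `M`-Lipschitz functions on `G/Γ`** in the uniform norm
(the first reduction in the proof of Prop. 11.2: "from the Arzelà–Ascoli theorem … the space of
Lipschitz functions `F` on `G/Γ` with Lipschitz constant at most `M` is equicontinuous and hence
compact in the uniform topology. In particular, it can be covered by finitely many balls …";
here by discretising the values on a finite net of points of the compact metric space `G/Γ`).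
The net functions are themselves in the class, hence continuous.
[cite: GreenTao2010, §11, proof of Prop. 11.2] -/
theorem exists_finite_net (M : ℝ) {ε : ℝ} (hε : 0 < ε) :
    ∃ (m : ℕ) (Fnet : Fin m → X.G ⧸ X.Γ → ℝ), (∀ i, Continuous (Fnet i)) ∧
      ∀ F, X.IsBoundedLipschitz M F → ∃ i, ∀ y, |F y - Fnet i y| ≤ ε := by
  classical
  letI := X.metricSpace
  set M₀ : ℝ := max M 0 with hM₀
  have hM₀ : 0 ≤ M₀ := le_max_right _ _
  have hMM₀ : M ≤ M₀ := le_max_left _ _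
  -- a finite `r`-net of points
  set r : ℝ := ε / (4 * (M₀ + 1)) with hr
  have hrpos : 0 < r := by positivity
  obtain ⟨t, -, htfin, hcover⟩ :=
    finite_cover_balls_of_compact (isCompact_univ (X := X.G ⧸ X.Γ)) hrpos
  -- profiles
  set η : ℝ := ε / 4 with hη
  have hηpos : 0 < η := by positivity
  let Prof : Type := htfin.toFinset → Set.Icc (⌊(-1 : ℝ) / η⌋) ⌊(1 : ℝ) / η⌋
  haveI : Fintype Prof := inferInstance
  let prof : (X.G ⧸ X.Γ → ℝ) → htfin.toFinset → ℤ := fun F p => ⌊F p.1 / η⌋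
  have hprof : ∀ F, X.IsBoundedLipschitz M F → ∀ p : htfin.toFinset,
      prof F p ∈ Set.Icc (⌊(-1 : ℝ) / η⌋) ⌊(1 : ℝ) / η⌋ := by
    intro F hF p
    have h1 := abs_le.mp (hF.1 p.1)
    exact ⟨Int.floor_mono (by rw [div_le_div_iff_of_pos_right hηpos]; exact h1.1),
      Int.floor_mono (by rw [div_le_div_iff_of_pos_right hηpos]; exact h1.2)⟩
  let profT : ∀ F, X.IsBoundedLipschitz M F → Prof := fun F hF p => ⟨prof F p, hprof F hF p⟩
  -- representatives
  let rep : Prof → X.G ⧸ X.Γ → ℝ := fun q =>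
    if hq : ∃ F, ∃ hF : X.IsBoundedLipschitz M F, profT F hF = q then hq.choose else fun _ => 0
  have hrep : ∀ q, X.IsBoundedLipschitz M (rep q) ∨ rep q = fun _ => 0 := by
    intro q
    by_cases hq : ∃ F, ∃ hF : X.IsBoundedLipschitz M F, profT F hF = q
    · left
      simp only [rep, dif_pos hq]
      exact hq.choose_spec.1
    · right
      simp only [rep, dif_neg hq]
  refine ⟨Fintype.card Prof, fun i => rep ((Fintype.equivFin Prof).symm i), fun i => ?_, ?_⟩
  · show Continuous (rep ((Fintype.equivFin Prof).symm i))
    rcases hrep ((Fintype.equivFin Prof).symm i) with h | h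
    · exact h.continuous
    · rw [h]; exact continuous_const
  · intro F hF
    refine ⟨Fintype.equivFin Prof (profT F hF), fun y => ?_⟩
    show |F y - rep ((Fintype.equivFin Prof).symm (Fintype.equivFin Prof (profT F hF))) y| ≤ ε
    rw [Equiv.symm_apply_apply]
    set q := profT F hF with hq
    have hq' : ∃ F', ∃ hF' : X.IsBoundedLipschitz M F', profT F' hF' = q := ⟨F, hF, rfl⟩
    have hrepq : rep q = hq'.choose := by simp only [rep, dif_pos hq']
    set F' := hq'.choose with hF'def
    have hF' : X.IsBoundedLipschitz M F' := hq'.choose_spec.1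
    have hprofeq : profT F' hF' = q := hq'.choose_spec.2
    rw [hrepq]
    -- a net point near `y`
    obtain ⟨p, hp, hyp⟩ : ∃ p ∈ t, Dist.dist y p < r := by
      have := hcover (Set.mem_univ y)
      simpa only [Set.mem_iUnion, Metric.mem_ball, exists_prop] using this
    have hpt : p ∈ htfin.toFinset := htfin.mem_toFinset.mpr hp
    -- same profile at `p`
    have hfloor : ⌊F p / η⌋ = ⌊F' p / η⌋ := by
      have e1 : (profT F hF ⟨p, hpt⟩).1 = ⌊F p / η⌋ := rfl
      have e2 : (profT F' hF' ⟨p, hpt⟩).1 = ⌊F' p / η⌋ := rfl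
      rw [← e1, ← e2, hprofeq]
    have hclose : |F p - F' p| < η := by
      have h1 := Int.floor_le (F p / η)
      have h2 := Int.lt_floor_add_one (F p / η)
      have h3 := Int.floor_le (F' p / η)
      have h4 := Int.lt_floor_add_one (F' p / η)
      rw [hfloor] at h1 h2
      rw [abs_lt]
      constructor
      · have : F' p / η - F p / η < 1 := by linarith
        rw [← sub_div, div_lt_one hηpos] at this
        linarith
      · have : F p / η - F' p / η < 1 := by linarith
        rw [← sub_div, div_lt_one hηpos] at this
        linarith
    -- Lipschitz steps
    have hd : 0 ≤ Dist.dist y p := _root_.dist_nonneg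
    have hL1 : |F y - F p| ≤ M₀ * r := by
      calc |F y - F p| ≤ M * X.dist y p := hF.2 y p
        _ ≤ M₀ * X.dist y p := mul_le_mul_of_nonneg_right hMM₀ hd
        _ ≤ M₀ * r := mul_le_mul_of_nonneg_left hyp.le hM₀
    have hL2 : |F' p - F' y| ≤ M₀ * r := by
      calc |F' p - F' y| ≤ M * X.dist p y := hF'.2 p y
        _ ≤ M₀ * X.dist p y := mul_le_mul_of_nonneg_right hMM₀ (X.dist_nonneg p y)
        _ ≤ M₀ * r := by
            refine mul_le_mul_of_nonneg_left ?_ hM₀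
            rw [X.dist_comm]; exact hyp.le
    have hMr : M₀ * r ≤ ε / 4 := by
      rw [hr, mul_div_assoc', div_le_div_iff₀ (by positivity) (by positivity)]
      nlinarith
    calc |F y - F' y| = |(F y - F p) + (F p - F' p) + (F' p - F' y)| := by ring_nf
      _ ≤ |F y - F p| + |F p - F' p| + |F' p - F' y| := abs_add_three _ _ _
      _ ≤ ε / 4 + ε / 4 + ε / 4 := by linarith [hclose.le]
      _ ≤ ε := by linarith

end Nilmanifold

/-! ### Cor. 11.6 for rational nilmanifolds -/

/-- A sum over `[1, N] ⊆ ℤ` is the corresponding sum over `[1, N] ⊆ ℕ`. [folklore] -/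
private theorem sum_Icc_int_eq_sum_Icc_nat_aux (G : ℤ → ℝ) (N : ℕ) :
    ∑ n ∈ Finset.Icc (1 : ℤ) N, G n = ∑ n ∈ Finset.Icc 1 N, G (n : ℕ) := by
  classical
  have himage : (Finset.Icc 1 N).image (fun n : ℕ => (n : ℤ)) = Finset.Icc (1 : ℤ) N := by
    ext m
    simp only [Finset.mem_image, Finset.mem_Icc]
    constructor
    · rintro ⟨n, ⟨h1, h2⟩, rfl⟩; exact ⟨by exact_mod_cast h1, by exact_mod_cast h2⟩
    · rintro ⟨h1, h2⟩
      exact ⟨m.toNat, ⟨by omega, by omega⟩, by omega⟩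
  rw [← himage, Finset.sum_image fun a _ b _ h => by exact_mod_cast h]

/-- **Cor. 11.6 ("Nilsequences obstruct uniformity, II") for nilmanifolds with rational lower
central series, PROVED**: for every `s`-step nilmanifold `X = G/Γ` satisfying Lemma E.9 and every
Lipschitz bound `M`, `GreenTao2010_nilObstructionAt s X M` — for `δ ∈ (0,1)` there is
`c = c(s, δ, M, G/Γ) > 0` such that for `N ≥ 1`, a `1`-bounded `M`-Lipschitz `F`, `g ∈ G`,
`x ∈ G/Γ` and `f : [N] → ℝ` with `𝔼_{n ∈ [N]} |f(n)| ≤ 1` and `|𝔼_{n ∈ [N]} f(n) F(gⁿx)| ≥ δ`, we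
have `‖f‖_{U^{s+1}[N]} ≥ c`. Proof as in §11 of the paper: finite `δ/4`-net of the Lipschitz
class; for each net function the cube approximation on the Host–Kra cube space (Prop. 11.5 and
Stone–Weierstrass) to accuracy `δ/4`; averaging over shifts and Gowers–Cauchy–Schwarz
(`abs_sum_mul_le_of_cubeApprox`). [cite: GreenTao2010, Cor. 11.6, Prop. 11.2, Prop. 11.5, App. E] -/
theorem GreenTao2010_nilObstructionAt_of_isRational {s : ℕ} (X : Nilmanifold s)
    (hX : X.IsRational) (M : ℝ) : GreenTao2010_nilObstructionAt s X M := by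
  classical
  intro δ hδ _hδ1
  obtain ⟨m, Fnet, hcont, hnet⟩ := X.exists_finite_net M (show 0 < δ / 4 by positivity)
  have happ : ∀ i : Fin m, ∃ (n : ℕ) (c : Fin n → ℝ)
      (B : Fin n → Finset (Fin (s + 1)) → X.G ⧸ X.Γ → ℝ),
      (∀ i ω z, |B i ω z| ≤ 1) ∧ (∀ i z, B i ∅ z = 1) ∧
        ∀ (g : X.G) (x : X.G ⧸ X.Γ) (m' : ℤ) (h : Fin (s + 1) → ℤ),
          |Fnet i (g ^ m' • x) -
              ∑ i', c i' * ∏ ω : Finset (Fin (s + 1)), B i' ω (g ^ (m' + ∑ j ∈ ω, h j) • x)| ≤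
            δ / 4 :=
    fun i => X.exists_cubeApprox hX (hcont i) (by positivity)
  choose n c B hB1 hB0 hBapp using happ
  set L : ℝ := ∑ i, ∑ j, |c i j| with hL
  have hL0 : 0 ≤ L := Finset.sum_nonneg fun i _ => Finset.sum_nonneg fun j _ => abs_nonneg _
  set C : ℝ := (2 * (2 * ((s : ℝ) + 1) + 1)) ^ (s + 1 + 1) with hC
  have hCpos : 0 < C := by positivity
  refine ⟨(δ / 2) / (C * (L + 1)), by positivity, ?_⟩
  intro N hN g x F hF f hfL1 hcorr
  have hNpos : (0 : ℝ) < N := by exact_mod_cast hN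
  obtain ⟨i, hi⟩ := hnet F hF
  set U := uniformityNorm (s + 1) N (fun n => ((f n : ℝ) : ℂ)) with hU
  have hU0 : 0 ≤ U := uniformityNorm_nonneg _ _ _
  -- the core estimate along the orbit, for the net function
  have hcore := abs_sum_mul_le_of_cubeApprox (k := s + 1) (Nat.succ_pos s) hN
    (fun m' : ℤ => Fnet i (g ^ m' • x)) (c i) (fun j ω m' => B i j ω (g ^ m' • x))
    (fun j ω m' => hB1 i j ω _) (fun j m' => hB0 i j _)
    (fun m' h _ _ _ => hBapp i g x m' h) f
  -- the `L¹` bound and the sums over `[N] ⊆ ℕ`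
  have hf1 : ∑ n ∈ Finset.Icc (1 : ℤ) N, |f n| ≤ N := by
    rwa [div_le_one hNpos] at hfL1
  have hsumZ : ∑ n ∈ Finset.Icc (1 : ℤ) N, f n * Fnet i (g ^ n • x) =
      ∑ n ∈ Finset.Icc 1 N, f (n : ℕ) * Fnet i (g ^ n • x) := by
    rw [sum_Icc_int_eq_sum_Icc_nat_aux (fun n : ℤ => f n * Fnet i (g ^ n • x)) N]
    refine Finset.sum_congr rfl fun n _ => ?_
    rw [zpow_natCast]
  -- comparing `F` and the net function along the orbit
  have hdiff : |∑ n ∈ Finset.Icc 1 N, f (n : ℕ) * F (g ^ n • x) -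
      ∑ n ∈ Finset.Icc 1 N, f (n : ℕ) * Fnet i (g ^ n • x)| ≤ δ / 4 * N := by
    rw [← Finset.sum_sub_distrib]
    refine (Finset.abs_sum_le_sum_abs _ _).trans ?_
    have h1 : ∀ n ∈ Finset.Icc 1 N, |f (n : ℕ) * F (g ^ n • x) - f (n : ℕ) * Fnet i (g ^ n • x)| ≤
        δ / 4 * |f (n : ℕ)| := by
      intro n _
      rw [← mul_sub, abs_mul, mul_comm]
      exact mul_le_mul_of_nonneg_right (hi _) (abs_nonneg _)
    refine (Finset.sum_le_sum h1).trans ?_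
    rw [← Finset.mul_sum, ← sum_Icc_int_eq_sum_Icc_nat_aux (fun n => |f n|) N]
    exact mul_le_mul_of_nonneg_left hf1 (by positivity)
  -- the correlation hypothesis
  have hcorr' : δ * N ≤ |∑ n ∈ Finset.Icc 1 N, f (n : ℕ) * F (g ^ n • x)| := by
    have h := hcorr
    unfold Nilmanifold.orbitAverage at h
    rw [abs_div, abs_of_pos hNpos, le_div_iff₀ hNpos] at h
    exact h
  -- combine
  have hmain : 3 * δ / 4 * N ≤ (∑ j, |c i j|) * C * N * U + δ / 4 * N := by
    have h1 : 3 * δ / 4 * N ≤ |∑ n ∈ Finset.Icc 1 N, f (n : ℕ) * Fnet i (g ^ n • x)| := by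
      have := abs_sub_abs_le_abs_sub (∑ n ∈ Finset.Icc 1 N, f (n : ℕ) * F (g ^ n • x))
        (∑ n ∈ Finset.Icc 1 N, f (n : ℕ) * Fnet i (g ^ n • x))
      linarith
    rw [← hsumZ] at h1
    have h2 : δ / 4 * ∑ n ∈ Finset.Icc (1 : ℤ) N, |f n| ≤ δ / 4 * N :=
      mul_le_mul_of_nonneg_left hf1 (by positivity)
    have h3 := hcore
    simp only [Nat.cast_add, Nat.cast_one] at h3
    rw [← hC, ← hU] at h3
    linarith
  have hLi : ∑ j, |c i j| ≤ L + 1 := by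
    have : ∑ j, |c i j| ≤ L := Finset.single_le_sum (f := fun i => ∑ j, |c i j|)
      (fun i _ => Finset.sum_nonneg fun j _ => abs_nonneg _) (Finset.mem_univ i)
    linarith
  have hkey : δ / 2 ≤ C * (L + 1) * U := by
    have h1 : δ / 2 * N ≤ (∑ j, |c i j|) * C * U * N := by nlinarith
    have h2 : δ / 2 ≤ (∑ j, |c i j|) * C * U := le_of_mul_le_mul_right h1 hNpos
    calc δ / 2 ≤ (∑ j, |c i j|) * C * U := h2
      _ = (∑ j, |c i j|) * (C * U) := by ring
      _ ≤ (L + 1) * (C * U) := mul_le_mul_of_nonneg_right hLi (by positivity)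
      _ = C * (L + 1) * U := by ring
  rw [div_le_iff₀ (by positivity)]
  linarith

/-- **Cor. 11.6 for all nilmanifolds of step `s ≤ 1`, unconditionally** (Lemma E.9 is vacuous
there): in particular for every `1`-step nilmanifold, not only the circle
(`GreenTao2010_nilObstructionAt_one_circle`). [cite: GreenTao2010, Cor. 11.6] -/
theorem GreenTao2010_nilObstructionAt_of_le_one {s : ℕ} (hs : s ≤ 1) (X : Nilmanifold s) (M : ℝ) :
    GreenTao2010_nilObstructionAt s X M :=
  GreenTao2010_nilObstructionAt_of_isRational X (X.isRational_of_le_one hs) M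

/-! ### What Thm. 7.2 and the Green–Tao–Ziegler theorem now rest on -/

/-- **Thm. 7.2 at level `s` from a rational `GI(s)` datum and Prop. 10.2**: if `GI(s)` holds at
every `δ ∈ (0,1]` with a family of nilmanifolds satisfying Lemma E.9 (as the nilmanifolds with
Mal'cev bases of Green–Tao–Ziegler do), and Prop. 10.2 holds for every `s`-step nilmanifold, then
`GreenTao2010_gowersUniformityAt s` (Prop. 6.4, Prop. 10.1 ⇐ `GI(s)` + Cor. 11.6, and Cor. 11.6
being theorems of the tree). [cite: GreenTao2010, Thm. 7.2, §10, Conj. 8.3, Cor. 11.6, Prop. 10.2] -/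
theorem GreenTao2010_gowersUniformityAt_of_rationalDatum {s : ℕ} (hs : 1 ≤ s)
    (hGI : ∀ δ : ℝ, 0 < δ → δ ≤ 1 → ∃ (m : ℕ) (𝓜 : Fin m → Nilmanifold s) (MG cG : ℝ),
      (∀ i, (𝓜 i).IsRational) ∧ GreenTao2010_inverseDatum s δ 𝓜 MG cG)
    (h102 : ∀ (X : Nilmanifold s) (M : ℝ), GreenTao2010_nilsequenceOrthogonalityAt s X M) :
    GreenTao2010_gowersUniformityAt s := by
  refine GreenTao2010_gowersUniformityAt_of_props hs GreenTao2010_pseudorandomDomination_holds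
    (fun δ hδ hδ1 C hC A => ?_) h102
  obtain ⟨m, 𝓜, MG, cG, hrat, hd⟩ := hGI (relInvParam s C δ) (relInvParam_pos s (by linarith) hδ)
    (relInvParam_le_one s (by linarith) hδ1)
  exact GreenTao2010_relativeInverseAt_of_datum hs hδ hC A hd fun i =>
    GreenTao2010_nilObstructionAt_of_isRational (𝓜 i) (hrat i) MG

/-- **`GreenTao2010_gowersUniformity` from `GI(s)` with rational data and Prop. 10.2, all `s`.**
[cite: GreenTao2010, Thm. 7.2, §10] -/
theorem GreenTao2010_gowersUniformity_of_rationalGI_of_orthogonality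
    (hGI : ∀ s : ℕ, 1 ≤ s → ∀ δ : ℝ, 0 < δ → δ ≤ 1 →
      ∃ (m : ℕ) (𝓜 : Fin m → Nilmanifold s) (MG cG : ℝ),
        (∀ i, (𝓜 i).IsRational) ∧ GreenTao2010_inverseDatum s δ 𝓜 MG cG)
    (h102 : ∀ s : ℕ, 1 ≤ s → ∀ (X : Nilmanifold s) (M : ℝ),
      GreenTao2010_nilsequenceOrthogonalityAt s X M) :
    GreenTao2010_gowersUniformity :=
  GreenTao2010_gowersUniformity_iff.mpr fun s hs =>
    GreenTao2010_gowersUniformityAt_of_rationalDatum hs (hGI s hs) (h102 s hs)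

/-- **`GreenTao2010_gowersUniformity` from Lemma E.9 (Mal'cev), `GI(s)` as printed, and
Prop. 10.2**: with Cor. 11.6 now a theorem for rational nilmanifolds, Thm. 7.2 for all `s` rests
on exactly these three inputs. [cite: GreenTao2010, Thm. 7.2, §10, Conj. 8.3, Prop. 10.2, App. E, Lemma E.9] -/
theorem GreenTao2010_gowersUniformity_of_malcev_of_GI_of_orthogonality
    (hE9 : ∀ (s : ℕ) (X : Nilmanifold s), X.IsRational)
    (hGI : ∀ s : ℕ, 1 ≤ s → ∀ δ : ℝ, 0 < δ → δ ≤ 1 → GreenTao2010_inverseConjectureAt s δ)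
    (h102 : ∀ s : ℕ, 1 ≤ s → ∀ (X : Nilmanifold s) (M : ℝ),
      GreenTao2010_nilsequenceOrthogonalityAt s X M) :
    GreenTao2010_gowersUniformity :=
  GreenTao2010_gowersUniformity_of_conjectures hGI
    (fun s _ X M => GreenTao2010_nilObstructionAt_of_isRational X (hE9 s X) M) h102

/-- **The Green–Tao–Ziegler theorem from Lemma E.9, `GI(s)` and Prop. 10.2.**
[cite: GreenTao2010, Main Theorem and §10] [cite: GreenTaoZiegler2012, Thm. 1.3] -/
theorem GreenTaoZiegler2012_finiteComplexity_of_malcev_of_GI_of_orthogonality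
    (hE9 : ∀ (s : ℕ) (X : Nilmanifold s), X.IsRational)
    (hGI : ∀ s : ℕ, 1 ≤ s → ∀ δ : ℝ, 0 < δ → δ ≤ 1 → GreenTao2010_inverseConjectureAt s δ)
    (h102 : ∀ s : ℕ, 1 ≤ s → ∀ (X : Nilmanifold s) (M : ℝ),
      GreenTao2010_nilsequenceOrthogonalityAt s X M) :
    GreenTaoZiegler2012_finiteComplexity :=
  GreenTaoZiegler2012_finiteComplexity_of_gowersUniformity
    (GreenTao2010_gowersUniformity_of_malcev_of_GI_of_orthogonality hE9 hGI h102)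

end Literature.NumberTheory.Sieve
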